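import Literature.NumberTheory.GaloisRepresentations.ProjectiveTypeSolvableAnyChar
import Literature.NumberTheory.GaloisRepresentations.DihedralTypeMonomial
import HarnessLib

/-!
# Irreducible dihedral-type representations are monomial, in arbitrary characteristic

Topic `Literature/NumberTheory/GaloisRepresentations`; theorems only (no definitions, no named
facts).  Companion of `DihedralTypeMonomial` (`exists_monomial_of_isDihedralType`: the same for
`char k = 0`, where no irreducibility hypothesis is needed) and an input of the proof of
Serre's modularity conjecture (`Literature.NumberTheory.Automorphic.khare_wintenberger`),
Khare–Wintenberger (I), proof of Lemma 6.3 (i), the sentence following the invocation of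
Dickson's theorem: "Suppose `ρ̄` is induced from `G_K` with `K` a quadratic extension of `ℚ`" —
i.e. an irreducible `ρ̄ : G_ℚ → GL₂(𝔽̄_p)` with dihedral projective image is induced from the
index-two subgroup `G_K` lying over the rotations.  In characteristic `p` the irreducibility
hypothesis cannot be dropped (the reducible group of matrices `(±1 b; 0 1)`, `b ∈ 𝔽_p`, has
projective image `D_p`), and it enters exactly once: to see that the rotation subgroup has
order prime to `p` (an element of order `p` in it would generate a *normal* subgroup of
unipotent classes, which has a common eigenline by
`PGL2AnyChar.hasCommonEigenvector_of_unipotents`), so that a lift of the generating rotation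
diagonalises (`CharTwoPGL2.exists_conj_eq_diagonal_of_mk_pow_eq_one`).

* `exists_monomial_of_isDihedralType_of_not_hasCommonEigenvector` — `k` algebraically closed of
  any characteristic, `ρ : G →* GL₂(k)` with finite image, without common eigenvector, of
  dihedral type: there are `H ≤ G` of index `2` and `P ∈ GL₂(k)` with `P ρ(h) P⁻¹` diagonal for
  `h ∈ H`, antidiagonal for `g ∉ H`, and some `h₀ ∈ H` with distinct diagonal entries
  (`ρ|_H = χ₁ ⊕ χ₂`, `χ₁ ≠ χ₂`, `ρ ≅ Ind_H^G χ₁`).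
* `DihedralGroup.conj_r_one` — in `D_m`, every conjugate of `r 1` is `r 1` or `r (-1)`.

## References

* [KhareWintenberger2009] C. Khare, J.-P. Wintenberger, *Serre's modularity conjecture (I)*,
  Invent. Math. 178 (2009), §6, proof of Lemma 6.3 (i).
* [Gelbart1997] S. Gelbart, *Three lectures on the modularity of `ρ̄_{E,3}` …*, Springer 1997,
  §4.3, Proposition (ii) (dihedral type = monomial; characteristic `0`).
-/

open Matrix Subgroup
open scoped MatrixGroups

/-- In the dihedral group `D_m`, every conjugate of the rotation `r 1` is `r 1` or `r (-1)`
(rotations commute; `s r s⁻¹ = r⁻¹` for a reflection `s`). [folklore] -/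
theorem DihedralGroup.conj_r_one {m : ℕ} (x : DihedralGroup m) :
    x * r 1 * x⁻¹ = r 1 ∨ x * r 1 * x⁻¹ = r (-1) := by
  cases x with
  | r i => left; simp [DihedralGroup.r_mul_r]
  | sr i => right; simp [DihedralGroup.sr_mul_r, DihedralGroup.sr_mul_sr]

namespace Literature.NumberTheory.GaloisRepresentations

variable {G : Type*} [Group G] {k : Type*} [Field k] [IsAlgClosed k]

open Matrix.ProjGenLinGroup in
/-- **Irreducible dihedral type ⇒ monomial, any characteristic.**  Let `k` be algebraically
closed (any characteristic) and `ρ : G →* GL₂(k)` have finite image, no common eigenvector,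
and dihedral projective image `\bar ρ(G) ≅ D_m`, `m ≥ 2`.  Then there are a subgroup `H ≤ G`
of index `2` and `P ∈ GL₂(k)` such that `P ρ(h) P⁻¹` is diagonal for all `h ∈ H`, antidiagonal
for all `g ∉ H`, and some `h₀ ∈ H` has `P ρ(h₀) P⁻¹ = diag(d₀, d₁)` with `d₀ ≠ d₁` (`H` is the
inverse image of the rotations; `ρ|_H ≅ χ₁ ⊕ χ₂`, `χ₁ ≠ χ₂`, `ρ ≅ Ind_H^G χ₁`: "`ρ̄` is induced
from `G_K` with `K` quadratic").  The statement of `exists_monomial_of_isDihedralType` with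
`char k = 0` replaced by the absence of a common eigenvector.
[cite: KhareWintenberger2009, §6, proof of Lemma 6.3 (i)] -/
theorem exists_monomial_of_isDihedralType_of_not_hasCommonEigenvector (ρ : G →* GL (Fin 2) k)
    [Finite ρ.range] (hce : ¬ HasCommonEigenvector ρ) (hρ : IsDihedralType ρ) :
    ∃ (H : Subgroup G) (P : GL (Fin 2) k), H.index = 2 ∧
      (∀ g, g ∈ H → GL2.IsDg ((conjGL P ρ g : GL (Fin 2) k) : Matrix (Fin 2) (Fin 2) k)) ∧
      (∀ g, g ∉ H → GL2.IsAd ((conjGL P ρ g : GL (Fin 2) k) : Matrix (Fin 2) (Fin 2) k)) ∧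
      ∃ h₀, h₀ ∈ H ∧ ((conjGL P ρ h₀ : GL (Fin 2) k) : Matrix (Fin 2) (Fin 2) k) 0 0 ≠
        ((conjGL P ρ h₀ : GL (Fin 2) k) : Matrix (Fin 2) (Fin 2) k) 1 1 := by
  classical
  obtain ⟨m, hm, ⟨e⟩⟩ := hρ
  haveI : Fact (1 < m) := ⟨hm⟩
  haveI : NeZero m := ⟨by omega⟩
  -- `θ : G → D_m`, the composite `G → \bar ρ(G) ≅ D_m`
  set π : G →* PGL(Fin 2, k) := Matrix.ProjGenLinGroup.mk.comp ρ with hπ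
  let πr : G →* projectiveImage ρ := π.rangeRestrict
  have hπr : ∀ g, ((πr g : projectiveImage ρ) : PGL(Fin 2, k)) = mk (ρ g) := fun g => rfl
  have hπrsurj : Function.Surjective πr := MonoidHom.rangeRestrict_surjective π
  let θ : G →* DihedralGroup m := e.toMonoidHom.comp πr
  have hθ : ∀ g, θ g = e (πr g) := fun g => rfl
  have hθsurj : Function.Surjective θ := e.surjective.comp hπrsurj
  -- the rotation subgroup and its inverse image `H`
  set R : Subgroup (DihedralGroup m) := zpowers (DihedralGroup.r 1) with hR
  have hRcard : Nat.card R = m := by rw [hR, Nat.card_zpowers, DihedralGroup.orderOf_r_one]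
  have hRindex : R.index = 2 := by
    have h1 := R.card_mul_index
    rw [hRcard, DihedralGroup.nat_card, mul_comm 2 m] at h1
    exact Nat.eq_of_mul_eq_mul_left (by omega) h1
  set H : Subgroup G := R.comap θ with hH
  have hHindex : H.index = 2 := by rw [hH, index_comap_of_surjective R hθsurj, hRindex]
  haveI hHn : H.Normal := normal_of_index_eq_two hHindex
  have hmemH : ∀ g, g ∈ H ↔ θ g ∈ R := fun g => Iff.rfl
  -- a lift `h₀` of the rotation `r 1`; its class `c₀` has order `m`
  obtain ⟨h₀, hh₀⟩ := hθsurj (DihedralGroup.r 1)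
  have hh₀H : h₀ ∈ H := by rw [hmemH, hh₀]; exact mem_zpowers _
  set c₀ : projectiveImage ρ := πr h₀ with hc₀
  have hec₀ : e c₀ = DihedralGroup.r 1 := hh₀
  have hc₀ord : orderOf c₀ = m := by
    rw [← MulEquiv.orderOf_eq e c₀, hec₀, DihedralGroup.orderOf_r_one]
  have hh₀nc : ρ h₀ ∉ center (GL (Fin 2) k) := by
    intro hc
    have h1 : c₀ = 1 := by
      apply Subtype.ext
      rw [hc₀, hπr, OneMemClass.coe_one, Matrix.ProjGenLinGroup.mk_eq_one]
      exact hc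
    rw [h1, orderOf_one] at hc₀ord
    omega
  -- every conjugate of `c₀` is `c₀` or `c₀⁻¹`
  have hconjc₀ : ∀ x : projectiveImage ρ, x * c₀ * x⁻¹ = c₀ ∨ x * c₀ * x⁻¹ = c₀⁻¹ := by
    intro x
    rcases DihedralGroup.conj_r_one (e x) with h | h
    · left
      apply e.injective
      rw [map_mul, map_mul, map_inv, hec₀, h]
    · right
      apply e.injective
      rw [map_mul, map_mul, map_inv, map_inv, hec₀, h, DihedralGroup.inv_r]
  -- **`m` is prime to `char k`**: otherwise the elements of order `p = char k` of `⟨c₀⟩` form a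
  -- conjugation-stable commuting family of unipotent classes with a common eigenvector
  have hmk : ((m : ℕ) : k) ≠ 0 := by
    intro hm0
    obtain ⟨p, hpchar⟩ := CharP.exists k
    have hpdvd : p ∣ m := (CharP.cast_eq_zero_iff k p _).mp hm0
    rcases CharP.char_is_prime_or_zero k p with hp | hp
    · haveI : Fact p.Prime := ⟨hp⟩
      have hu : orderOf (c₀ ^ (m / p)) = p := by
        rw [← hc₀ord] at hpdvd ⊢
        exact orderOf_pow_orderOf_div (by rw [hc₀ord]; omega) hpdvd
      set u : projectiveImage ρ := c₀ ^ (m / p) with hu_def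
      have hu1 : u ≠ 1 := by
        intro h
        rw [h, orderOf_one] at hu
        exact hp.one_lt.ne hu
      have hup : u ^ p = 1 := by rw [← hu]; exact pow_orderOf_eq_one u
      -- conjugates of `u` are `u` or `u⁻¹`
      have hconju : ∀ x : projectiveImage ρ, x * u * x⁻¹ ∈ zpowers u := by
        intro x
        have : x * u * x⁻¹ = (x * c₀ * x⁻¹) ^ (m / p) := by rw [hu_def, conj_pow]
        rw [this]
        rcases hconjc₀ x with h | h
        · rw [h]; exact mem_zpowers _
        · rw [h, inv_pow]; exact inv_mem (mem_zpowers _)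
      apply hce
      let S : Set G := {g | πr g ∈ zpowers u ∧ mk (ρ g) ≠ 1}
      have hSmem : ∀ g, g ∈ S ↔ (πr g ∈ zpowers u ∧ mk (ρ g) ≠ 1) := fun g => Iff.rfl
      -- elements of `⟨u⟩` have `p`-th power `1`
      have hzp : ∀ x ∈ zpowers u, x ^ p = 1 := by
        intro x hx
        obtain ⟨i, rfl⟩ := mem_zpowers_iff.mp hx
        rw [← zpow_natCast, ← zpow_mul, mul_comm, zpow_mul, zpow_natCast, hup, one_zpow]
      refine PGL2AnyChar.hasCommonEigenvector_of_unipotents ρ S ?_ ?_ ?_ ?_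
      · obtain ⟨gu, hgu⟩ := hπrsurj u
        refine ⟨gu, (hSmem gu).2 ⟨by rw [hgu]; exact mem_zpowers u, fun h => hu1 ?_⟩⟩
        apply Subtype.ext
        rw [← hgu, hπr, OneMemClass.coe_one]
        exact h
      · intro s hs
        refine ⟨((hSmem s).1 hs).2, ?_⟩
        have := congrArg Subtype.val (hzp _ ((hSmem s).1 hs).1)
        rwa [Subgroup.coe_pow, OneMemClass.coe_one, hπr] at this
      · intro s hs t ht
        obtain ⟨i, hi⟩ := mem_zpowers_iff.mp ((hSmem s).1 hs).1
        obtain ⟨j, hj⟩ := mem_zpowers_iff.mp ((hSmem t).1 ht).1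
        have h1 : πr s * πr t = πr t * πr s := by
          rw [← hi, ← hj, ← zpow_add, ← zpow_add, add_comm]
        have := congrArg Subtype.val h1
        rwa [Subgroup.coe_mul, Subgroup.coe_mul, hπr, hπr] at this
      · intro g s hs
        obtain ⟨hsu, hs1⟩ := (hSmem s).1 hs
        refine (hSmem _).2 ⟨?_, ?_⟩
        · have h1 : πr (g⁻¹ * s * g) = (πr g)⁻¹ * πr s * (πr g)⁻¹⁻¹ := by
            rw [map_mul, map_mul, map_inv, inv_inv]
          rw [h1]
          obtain ⟨i, hi⟩ := mem_zpowers_iff.mp hsu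
          rw [← hi]
          have h2 : (πr g)⁻¹ * u ^ i * (πr g)⁻¹⁻¹ = ((πr g)⁻¹ * u * (πr g)⁻¹⁻¹) ^ i := by
            rw [conj_zpow]
          rw [h2]
          exact Subgroup.zpow_mem _ (hconju _) i
        · intro h
          apply hs1
          simp only [map_mul, map_inv] at h
          have h4 : mk (ρ s) =
              mk (ρ g) * ((mk (ρ g))⁻¹ * mk (ρ s) * mk (ρ g)) * (mk (ρ g))⁻¹ := by group
          rw [h4, h, mul_one, mul_inv_cancel]
    · subst hp
      haveI := CharP.charP_to_charZero k
      have : (m : k) ≠ 0 := Nat.cast_ne_zero.mpr (by omega)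
      exact this hm0
  -- diagonalise `ρ h₀`
  have hc₀m : mk (ρ h₀) ^ m = 1 := by
    have h1 : c₀ ^ m = 1 := by rw [← hc₀ord]; exact pow_orderOf_eq_one c₀
    have := congrArg Subtype.val h1
    rwa [Subgroup.coe_pow, OneMemClass.coe_one, hc₀, hπr] at this
  obtain ⟨Q, d, hd, hQ⟩ := CharTwoPGL2.exists_conj_eq_diagonal_of_mk_pow_eq_one (ρ h₀) hmk hc₀m hh₀nc
  -- conjugate by `P = Q⁻¹`
  set P : GL (Fin 2) k := Q⁻¹ with hP
  set ρ' : G →* GL (Fin 2) k := conjGL P ρ with hρ'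
  have hρ'h₀ : ((ρ' h₀ : GL (Fin 2) k) : Matrix (Fin 2) (Fin 2) k) = diagonal d := by
    rw [hρ', conjGL_apply, hP, inv_inv, hQ]
  -- elements of `H` commute with `h₀`: `θ g ∈ ⟨r⟩` forces `\bar ρ(g) = \bar ρ(h₀)^i`
  have hcomm : ∀ g, g ∈ H → Commute (ρ g) (ρ h₀) := by
    intro g hg
    rw [hmemH] at hg
    obtain ⟨i, hi⟩ := mem_zpowers_iff.mp hg
    have h1 : πr g = πr h₀ ^ i := by
      apply e.injective
      rw [map_zpow, ← hθ, ← hθ, hh₀, hi]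
    have h2 : mk (ρ g) = mk (ρ h₀ ^ i) := by
      rw [← hπr, h1, map_zpow]; rfl
    obtain ⟨u, hu⟩ := Matrix.ProjGenLinGroup.mk_eq_mk_iff.mp h2
    have hsc : Matrix.GeneralLinearGroup.scalar (Fin 2) u ∈ center (GL (Fin 2) k) := by
      rw [Matrix.GeneralLinearGroup.center_eq_range_scalar]; exact ⟨u, rfl⟩
    have h3 : ρ g = ρ h₀ ^ i * (Matrix.GeneralLinearGroup.scalar (Fin 2) u)⁻¹ := by
      rw [← hu, mul_inv_cancel_right]
    rw [h3]
    exact ((Commute.refl (ρ h₀)).zpow_left i).mul_left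
      ((mem_center_iff.mp (inv_mem hsc)) (ρ h₀)).symm
  have hDg : ∀ g, g ∈ H → GL2.IsDg ((ρ' g : GL (Fin 2) k) : Matrix (Fin 2) (Fin 2) k) := by
    intro g hg
    refine GL2.isDg_of_commute_diagonal hd ?_
    rw [← hρ'h₀, ← Matrix.GeneralLinearGroup.coe_mul, ← Matrix.GeneralLinearGroup.coe_mul]
    congr 1
    exact ((hcomm g hg).map (MulAut.conj P).toMonoidHom).eq
  -- elements outside `H` are diagonal or antidiagonal …
  have hDgAd : ∀ g, GL2.IsDg ((ρ' g : GL (Fin 2) k) : Matrix (Fin 2) (Fin 2) k) ∨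
      GL2.IsAd ((ρ' g : GL (Fin 2) k) : Matrix (Fin 2) (Fin 2) k) := by
    intro g
    have hconj : g * h₀ * g⁻¹ ∈ H := hHn.conj_mem h₀ hh₀H g
    have hy := (hDg _ hconj).eq_diagonal
    refine GL2.isDg_or_isAd_of_mul_diagonal (GL2.det_ne_zero (ρ' g)) hd
      (d' := ![((ρ' (g * h₀ * g⁻¹) : GL (Fin 2) k) : Matrix (Fin 2) (Fin 2) k) 0 0,
        ((ρ' (g * h₀ * g⁻¹) : GL (Fin 2) k) : Matrix (Fin 2) (Fin 2) k) 1 1]) ?_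
    rw [← hy, ← hρ'h₀, ← Matrix.GeneralLinearGroup.coe_mul, ← Matrix.GeneralLinearGroup.coe_mul]
    congr 1
    rw [map_mul, map_mul, map_inv, inv_mul_cancel_right]
  -- … and not diagonal, lest `ρ` have a common eigenvector
  have hAd : ∀ g, g ∉ H → GL2.IsAd ((ρ' g : GL (Fin 2) k) : Matrix (Fin 2) (Fin 2) k) := by
    intro g hg
    rcases hDgAd g with hdg | had
    · exfalso
      apply hce
      refine HasCommonEigenvector.of_conjGL (P := P) (hasCommonEigenvector_of_forall_isDg fun g' => ?_)
      by_cases hg' : g' ∈ H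
      · exact hDg g' hg'
      · have hmem : g⁻¹ * g' ∈ H := by
          rw [mul_mem_iff_of_index_two hHindex]
          exact iff_of_false (fun h => hg (inv_mem_iff.mp h)) hg'
        have : g' = g * (g⁻¹ * g') := by group
        rw [this, map_mul, Matrix.GeneralLinearGroup.coe_mul]
        exact hdg.mul (hDg _ hmem)
    · exact had
  refine ⟨H, P, hHindex, hDg, hAd, h₀, hh₀H, ?_⟩
  rw [hρ'h₀, diagonal_apply_eq, diagonal_apply_eq]
  exact hd

/-- The same from irreducibility of the standard representation (the form of the hypothesis in
Khare–Wintenberger: `ρ̄` of `S`-type with dihedral projective image is induced from the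
quadratic field of the rotations). [cite: KhareWintenberger2009, §6, proof of Lemma 6.3 (i)] -/
theorem exists_monomial_of_isDihedralType_of_isIrreducible (ρ : G →* GL (Fin 2) k)
    [Finite ρ.range] (hirr : (toStdRepresentation ρ).IsIrreducible) (hρ : IsDihedralType ρ) :
    ∃ (H : Subgroup G) (P : GL (Fin 2) k), H.index = 2 ∧
      (∀ g, g ∈ H → GL2.IsDg ((conjGL P ρ g : GL (Fin 2) k) : Matrix (Fin 2) (Fin 2) k)) ∧
      (∀ g, g ∉ H → GL2.IsAd ((conjGL P ρ g : GL (Fin 2) k) : Matrix (Fin 2) (Fin 2) k)) ∧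
      ∃ h₀, h₀ ∈ H ∧ ((conjGL P ρ h₀ : GL (Fin 2) k) : Matrix (Fin 2) (Fin 2) k) 0 0 ≠
        ((conjGL P ρ h₀ : GL (Fin 2) k) : Matrix (Fin 2) (Fin 2) k) 1 1 :=
  exists_monomial_of_isDihedralType_of_not_hasCommonEigenvector ρ
    (not_hasCommonEigenvector_of_isIrreducible ρ hirr) hρ

end Literature.NumberTheory.GaloisRepresentations
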